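import Mathlib
import Summits.ResolutionOfSingularities.ResolutionOfSingularities.Theorems.HomologicalConductorNoZenoSplitChartGerm
import Summits.ResolutionOfSingularities.ResolutionOfSingularities.Theorems.HomologicalConductorNoZenoL1CoreRational
import HarnessLib

/-!
# D2′ PART 4e: INTEGRATION TEST — the upstairs binders of `Sig.L1Core`, assembled

W4.4 (crux `NoZenoR`, stmt-ResolutionOfSingularities-19943), `stub_L1wCore` route (F1), descent
step (B2) of `L1W-PREP-v2/v3` §2.1 (res-L0-w44-stub-2).  One theorem, `exists_upstairs_binders`,
takes the binder list of the thread-free core `Sig.L1Core` (res-L0-w44-lead-1, registry v28–v32)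
LITERALLY — `T, P, hP`, `EssFiniteType k T`, `IsIntegrallyClosed T`, `IsFractionRing T K`, `C ⊆ T`,
`√((C)·T_P) = 𝔪`, `x ∈ C`, `x ≠ 0`, `B = k[T_P ∪ C·x⁻¹]`, `𝔮 ⊂ nrm B` prime, `D'` local with
`locPrime (nrm B) 𝔮 = D'`, `T_P ⊆ D'`, `dim D' = 2`, `D'` normal — together with a splitting
polynomial `f ∈ T_P[X]` (monic, irreducible separable reduction; BC-0), and RETURNS the same binder
list UPSTAIRS over `K_f = K[X]/(f_K)` for the model `T_f := splitModel`, the prime `P_f := splitPrime`,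
the germ `D_f := locPrime T_f P_f`, `C_f := C` read in `K_f`, `x_f`, the chart ring
`B_f := k[D_f ∪ C_f·x_f⁻¹]` (verbatim `Algebra.adjoin`) and a prime `𝔮'` OF `nrm B_f` (verbatim) with
`D'_f := locPrime (nrm B_f) 𝔮'`: `C_f ⊆ T_f`, `√((C_f)·D_f) = 𝔪`, `x_f ∈ C_f`, `x_f ≠ 0`,
`D_f ⊆ D'_f`, `dim D'_f = 2`, `D'_f` normal — plus the DESCENT clauses `D'_f regular ↔ D' regular`
and (Lipman (16.5) as a hypothesis) `D' rational ⇒ D'_f rational`.  Everything is assembled BY NAME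
from `…NoZenoSplitData{,Thread}`, `…SplitLiftModel`, `…SplitFibreGerm`, `…SplitChart{,Germ}`; the
kernel thereby certifies that the two spellings of the germs (`locPrime` / `locPrimeSubalgebra`) and
of `nrm` (route `Birth.nrm` / `SyzygyFlattening.nrm`) interchange as claimed.

The `Prop` `Sig.L1Core` itself is NOT imported (no Theses / Cruxes file is): its binder shapes are
mirrored.  OURS (cell res-hironaka, chain W4.4); AI-written, weaker than expert review; nothing here
is a statement of the manuscript under review (Hironaka 2017).
-/

noncomputable section

set_option linter.dupNamespace false

open IsLocalRing Polynomial
open Summit.ResolutionOfSingularities.ResolutionOfSingularities.Theorems.NoZeno.SandwichCluster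
open Parasite (locPrime isLocalRing_locPrime mem_locPrime_of_mem)
open Thread (toSubring_le_locPrime)
open Summit.ResolutionOfSingularities.ResolutionOfSingularities.Theorems.NoZeno.Birth (nrm nrm_eq_nrm)
open Summit.ResolutionOfSingularities.ResolutionOfSingularities.Theorems.SyzygyFlattening
  (self_le_nrm isIntegrallyClosed_nrm stub_essFiniteType_nrm)

namespace Summit.ResolutionOfSingularities.ResolutionOfSingularities.Theorems.NoZeno.SplittingBase

variable {k K : Type} [Field k] [Field K] [Algebra k K]

open Literature.AlgebraicGeometry.Resolution in
/-- **D2′ — the upstairs binders of `Sig.L1Core`, assembled (integration test).**  See the module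
docstring for the dictionary.  Inputs: the `Sig.L1Core` binders verbatim and a splitting polynomial
`f` over the germ `T_P` (as `locPrimeSubalgebra T P`).  Output: a prime `𝔮'` of `nrm B_f` such that
the upstairs binder list holds for `D'_f := locPrime (nrm B_f) 𝔮'`, with the descent clauses.
[this work; the rationality clause is conditional on the named fact `Lipman1969_16_5`] -/
theorem exists_upstairs_binders (T : Subalgebra k K) (P : Ideal ↥T) (hP : P.IsPrime)
    [Algebra.EssFiniteType k ↥T] [IsIntegrallyClosed ↥T] [IsFractionRing ↥T K]
    (f : (↥(locPrimeSubalgebra T P hP))[X]) (hf : f.Monic)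
    (hirr : Irreducible (f.map (residue ↥(locPrimeSubalgebra T P hP))))
    (hsep : (f.map (residue ↥(locPrimeSubalgebra T P hP))).Separable)
    [Fact (Irreducible (f.map (algebraMap ↥(locPrimeSubalgebra T P hP) K)))]
    (hPf : (splitPrime (locPrimeSubalgebra T P hP) f).IsPrime)
    (C : Set K) (hCT : C ⊆ (T : Set K))
    (hrad : (Ideal.span {d : ↥(locPrime T P hP) | (d : K) ∈ C}).radical =
      @maximalIdeal ↥(locPrime T P hP) _ (isLocalRing_locPrime T P hP))
    (x : K) (hxC : x ∈ C) (hx0 : x ≠ 0) (B : Subalgebra k K)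
    (hB : B = Algebra.adjoin k ((locPrime T P hP : Set K) ∪ {y : K | ∃ c ∈ C, y = c * x⁻¹}))
    (𝔮 : Ideal ↥(nrm B)) (h𝔮 : 𝔮.IsPrime) (D' : Subring K) (hD' : IsLocalRing ↥D')
    (hEq : locPrime (nrm B) 𝔮 h𝔮 = D') (hdim' : ringKrullDim ↥D' = 2) (hnorm' : IsIntegrallyClosed ↥D') :
    ∃ (𝔮' : Ideal ↥(nrm (Algebra.adjoin k
        ((locPrime (splitModel (locPrimeSubalgebra T P hP) f) (splitPrime (locPrimeSubalgebra T P hP) f) hPf :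
            Set (AdjoinRoot (f.map (algebraMap ↥(locPrimeSubalgebra T P hP) K)))) ∪
          {y | ∃ c ∈ algebraMap K (AdjoinRoot (f.map (algebraMap ↥(locPrimeSubalgebra T P hP) K))) '' C,
            y = c * (algebraMap K (AdjoinRoot (f.map (algebraMap ↥(locPrimeSubalgebra T P hP) K))) x)⁻¹}))))
      (h𝔮' : 𝔮'.IsPrime),
      -- upstairs `C ⊆ T`, `√ = 𝔪`, `x ∈ C`, `x ≠ 0`
      algebraMap K (AdjoinRoot (f.map (algebraMap ↥(locPrimeSubalgebra T P hP) K))) '' C ⊆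
        (splitModel (locPrimeSubalgebra T P hP) f : Set _) ∧
      (Ideal.span {d : ↥(locPrime (splitModel (locPrimeSubalgebra T P hP) f)
          (splitPrime (locPrimeSubalgebra T P hP) f) hPf) |
          (d : AdjoinRoot (f.map (algebraMap ↥(locPrimeSubalgebra T P hP) K))) ∈
            algebraMap K (AdjoinRoot (f.map (algebraMap ↥(locPrimeSubalgebra T P hP) K))) '' C}).radical =
        @maximalIdeal _ _ (isLocalRing_locPrime _ _ hPf) ∧
      algebraMap K (AdjoinRoot (f.map (algebraMap ↥(locPrimeSubalgebra T P hP) K))) x ∈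
        algebraMap K (AdjoinRoot (f.map (algebraMap ↥(locPrimeSubalgebra T P hP) K))) '' C ∧
      algebraMap K (AdjoinRoot (f.map (algebraMap ↥(locPrimeSubalgebra T P hP) K))) x ≠ 0 ∧
      -- upstairs `D ⊆ D'`, `dim D' = 2`, `D'` normal, for `D'_f := locPrime (nrm B_f) 𝔮'`
      (locPrime (splitModel (locPrimeSubalgebra T P hP) f) (splitPrime (locPrimeSubalgebra T P hP) f) hPf :
          Set (AdjoinRoot (f.map (algebraMap ↥(locPrimeSubalgebra T P hP) K)))) ⊆
        (locPrime _ 𝔮' h𝔮' : Set (AdjoinRoot (f.map (algebraMap ↥(locPrimeSubalgebra T P hP) K)))) ∧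
      ringKrullDim ↥(locPrime _ 𝔮' h𝔮') = 2 ∧ IsIntegrallyClosed ↥(locPrime _ 𝔮' h𝔮') ∧
      -- descent
      (IsRegularLocalRing ↥(locPrime _ 𝔮' h𝔮') ↔ IsRegularLocalRing ↥D') ∧
      (Lipman1969_16_5.{0} → HasRationalSingularity ↥D' → HasRationalSingularity ↥(locPrime _ 𝔮' h𝔮')) := by
  subst hEq
  -- the chart ring `B ⊇ T_P`, its normalisation `R := nrm B` (Noetherian, normal, `Frac = K`)
  have hDB : locPrimeSubalgebra T P hP ≤ B := fun y hy => by
    rw [hB]; exact Algebra.subset_adjoin (Or.inl hy)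
  haveI : IsFractionRing ↥B K :=
    Literature.AlgebraicGeometry.Resolution.isFractionRing_subalgebra_of_le _ B hDB
  haveI : Algebra.EssFiniteType k ↥B := Thread.essFiniteType_blowupChart T P hP C hCT x B hB
  haveI : Algebra.EssFiniteType k ↥(nrm B) := stub_essFiniteType_nrm k K B inferInstance inferInstance
  haveI : IsNoetherianRing ↥(nrm B) := Algebra.EssFiniteType.isNoetherianRing k _
  haveI : IsIntegrallyClosed ↥(nrm B) := isIntegrallyClosed_nrm B
  haveI : IsFractionRing ↥(nrm B) K :=
    Literature.AlgebraicGeometry.Resolution.isFractionRing_subalgebra_of_le B _ (self_le_nrm B)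
  have hDR : locPrimeSubalgebra T P hP ≤ nrm B := hDB.trans (self_le_nrm B)
  haveI : IsNoetherianRing ↥T := Algebra.EssFiniteType.isNoetherianRing k ↥T
  have hu : IsUnit (AdjoinRoot.mk f (derivative f)) := isUnit_mk_derivative_of_separable_map hf hsep
  -- the chart germ package of PART 4d, for some prime `𝔮f` of `k[nrm B ∪ {β}]` over `𝔮`
  obtain ⟨𝔮f, h𝔮f, φ, hover, hsub, -, -, -, -, -, hIC, hdim, hreg⟩ :=
    exists_chartGermData (locPrimeSubalgebra T P hP) (nrm B) hDR f 𝔮 h𝔮 hf hirr hsep hPf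
  -- `nrm B_f = k[nrm B ∪ {β}]` (PART 4c), and the transport of `𝔮f` to a prime of `nrm B_f`
  have hNrm := (congrArg nrm (adjoin_chart_eq T P hP f hf hirr hPf C x B hB)).trans
    (nrm_chart_eq T P hP f hf hsep B hDB)
  have hL := locPrime_comap_equivOfEq _ _ hNrm 𝔮f h𝔮f
  refine ⟨𝔮f.comap (Subalgebra.equivOfEq _ _ hNrm : _ →+* _), Ideal.comap_isPrime _ _,
    ?_, radical_span_image_eq T P hP f hf hirr hPf C (fun c hc => toSubring_le_locPrime T P hP (hCT hc)) hrad,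
    ⟨x, hxC, rfl⟩, (_root_.map_ne_zero _).mpr hx0, ?_, ?_, ?_, ?_, ?_⟩
  · rintro _ ⟨c, hc, rfl⟩
    exact algebraMap_mem_splitModel _ f (le_locPrimeSubalgebra T P hP (hCT hc))
  · rw [hL]; exact hsub
  · rw [hL]; exact hdim.trans hdim'
  · rw [hL]; exact hIC
  · rw [hL]; exact hreg
  · intro h16_5 hrat
    rw [hL]
    exact hasRationalSingularity_chartGerm (locPrimeSubalgebra T P hP) (nrm B) hDR f 𝔮 h𝔮 𝔮f h𝔮f hover
      h16_5 hf hu hdim' hrat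

end Summit.ResolutionOfSingularities.ResolutionOfSingularities.Theorems.NoZeno.SplittingBase

end
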